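import Summits.QuantumFields.YangMills.Theorems.BalabanUVNodesN27AtAdmReadingOfRecord12
import Summits.QuantumFields.YangMills.Theorems.BalabanUVNodesN18AdmTransportPlaqSmall

/-!
# BalabanUVNodes ∕ N27 = binder B5 AT THE RECORD, XXXII — N27 AT THE ε-SMALL FIELDS: XXXI's junctions at dag-n18-d's PLAQUETTE-SMALL tables
# `(k, j, Y) ↦ (ι·, 0) '' {V | PlaqSmall (a F θ k) V}` with the TRANSPORT OF RECORD `transportRaw F k (avOfRecord F N (k+1) 0)`, the transport clause of the admissible
# reading DISCHARGED by [B7] Prop. 1 (dag-n18-d module 13 `admTransport_plaqSmall_sharp`: the print's step law on the thresholds), N18 from THE END's data ON THOSE TABLES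
# (module 13 §6, verbatim), N22 from N18 (dag-n22-e module 8a) with its letters asked AT THE ε-SMALL FIELDS
# (cell `pub-ymgap`, HUMAN RULING D-0062 Track A, R134 seat `pub-ymgap-dag-n27-c` (s2) gen 5; `--supports` the K3′ item `SpineGivenEndpointR12` stmt-QuantumFields-19908
# `--as helper`; COUNT-NEUTRAL; `N`-generic, regime-generic, NO Theses import, restate-immune; 0 `def`, 0 `sorry`)

WHY.  XXXI (p486900) is generic in the admissible reading's table family `sp`, transports `T₀` and their preservation clause `hT` — a DISPLAYED parameter of
`ReadingData.ofRecordAdm` ([I] (0.21)–(0.22) ∕ Lemma 1 content).  For ONE family that clause is now a THEOREM of the tree: dag-n18-d module 13 (p485563) — the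
plaquette-small tables ([I] (0.18) p. 255 «|∂V − 1| < ε₀», thresholds `a F θ k` per torus) with the transport of record, under the print's step law
`L²·a_{k+1} + 143·((((d+4)L)²∕4)·a_{k+1})² ≤ a_k` ([B7] Prop. 1 (51) `L²α₀ + C₀(L²α₀)²`, by name through dag-n21-c's `plaqSmall_blockAvg_eml_sharp`), the sign `0 < a_{k+1}` and the
chart guard `(((d+4)L)²∕4)·a_{k+1} ≤ δ_N∕2`; and module 13 §6 states N18's row there with the restriction clauses trivial (constant tables) and no transport clause.  This
module is XXXI at that family: K3′'s rate side AT THE ε-SMALL FIELDS, with the transport clause gone and the N18 ∕ N22 letters read at `PlaqSmall (a F θ k) U` in closed form.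

FIELD-BY-FIELD (differences to XXXI only).  The reading is `ReadingData.ofRecordAdm F θ.τ9.M N (S F θ) (plaquette-small tables of `a F θ`) (gauge F θ) (hg F θ)
(k ↦ transportRaw F k (avOfRecord F N (k+1) 0)) (admTransport_plaqSmall_sharp a ha hstep hguard F θ) (li F θ)`; section hypotheses `ha` ∕ `hstep` ∕ `hguard` are the three
threshold conditions above.
* N18 — §1: THE END's data over the admissible carriers of the plaquette-small pairing + `AnalyticH` ∕ `Bound238` of `S F θ k ∕ (k+1)` ON THE PLAQUETTE-SMALL TABLES of the two
  tori + letters dominating (dag-n18-d `s_N18_readingAdmPlaqSmall₁₂_of_envelope_bound238`, verbatim); §2: closed form at θ — for every `U` with `PlaqSmall (a F θ (k+1)) U`,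
  `|Re E^{(j)}_{S F θ k}(X; g; (ι(M U), 0)) − Re E^{(j+1)}_{S F θ (k+1)}(πX; b∷g; (ιU, 0))| ≤ C₅·θ₅^j·e^{−κ d_j(X)}`, `M` the transport of record (dag-n18-d m13 §5's shape).
* N22 — ELIMINATED given N18 (dag-n22-e 8a): §1 the analytic sup-letter (A) for `Re E^{(j)}_{S F θ k}(X; g[i ↦ ·]; (ιU, 0))` asked for every `U` with `PlaqSmall (a F θ k) U`; §2
  STRIP-(1.18) for `E^{(j)}_{S F θ k}(Y; g[i ↦ ·]; (ιV, 0))` asked for every `V` with `PlaqSmall (a F θ k) V`; (J) and the numerals as in 8a.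
* N14, N15, N16 (`InEndRegime ∧ LeafSlot`), N17 (eliminated), (D4), spine side — as XXXI.

WHAT THIS MODULE PROVES ([bookkeeping]; each theorem ONE application of XXXI with dag-n18-d's m13 in the slots and the closed-form ↔ `AdmBg` conversions
`mem_image_ofBackgroundC_iff` ∕ `obtain ⟨V, hV, rfl⟩`).
* §1 `spine_rec12C_at_epsSmallFields₁₂_of_envelope_bound238` — canonical home ⇒ `Spine ₁₂C`.
* §2 `spine_rec12COn_at_epsSmallFields₁₂` — regime home, any `Rg` ⇒ `Spine` at `IsRecordOfRecord₁₂COn F N Rg`; THE ITEM at `N = 2`, `Rg := Node00.unityNondeg₁₂ N` by XXVI §6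
  `spineGivenEndpointR12_of_spine_rec12COn` at the call site.

HONEST FRAMING.  COUNT-NEUTRAL kernel bookkeeping BY NAME at a COMPOSITE node; every node estimate is a DISPLAYED hypothesis or a producer's displayed hypothesis carried
verbatim; whether Bałaban's (2.14) terms carry `AnalyticH` ∕ `Bound238` (or STRIP ∕ (A)) on the ε-small tables — plaquette-small ⊆ `U^c_j(X, α₀, α₁)` by [I] (1.11)–(1.16) — is
asserted NOWHERE here (dag-n18-d m13 §6's own caveat); the thresholds `a`, towers `S`, gauges, letters `li`, `ne2`, `ne1` are θ-keyed DATA (INHABITATION IS NOT CONTENT; positive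
thresholds make the tables inhabited — dag-n18-d `admBg_plaqSmall_nonempty` — and termless towers make the tower clauses vacuous); no inhabitant of any record class is claimed
(K0′ `Record12Inhabited`, stmt-QuantumFields-19902, open; Record 13 in review); nothing of Bałaban's asserted or instantiated; NE1′–NE9 ∕ NE7 ∕ NE7b ∕ NE7c are NOT PRINTED for
d = 4 and NOT PROVED; N27 NOT discharged, K3′ NOT claimed; counts UNMOVED (typed 28∕28 · discharged 5∕27, A 5∕28); one finite four-torus programme at fixed `ε` — NOT ℝ⁴, NOT
infinite volume, NOT OS, NOT a mass gap, NOT Clay.  General-`N` throughout (the chart guard reads `deltaSU (Fin N)`; nothing uses `N = 2`).  No decl below carries a cite tag.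
-/

noncomputable section

open Set Metric
open scoped Matrix.Norms.L2Operator

namespace Summit.QuantumFields.YangMills.Theorems.BalabanUVNodesN27SpineRecord

open Literature.MathematicalPhysics.QuantumFieldTheory.Balaban1983to89
open Literature.MathematicalPhysics.QuantumFieldTheory.Balaban1983to89.T4Continuum
open Literature.MathematicalPhysics.QuantumFieldTheory.Balaban1983to89.T4OutputRate (Carriers Functional NE5 DecayBound Window)
open Literature.MathematicalPhysics.QuantumFieldTheory.Balaban1983to89.T4InputCauchyRateData (StepModel)
open Literature.MathematicalPhysics.QuantumFieldTheory.Balaban1983to89.B13Resummation (locE)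
open Literature.MathematicalPhysics.QuantumFieldTheory.Balaban1983to89.TreeLengthTorus (TDom tsys torusTreeLen)
open Literature.MathematicalPhysics.QuantumFieldTheory.Balaban1983to89.TreeLengthTorusGeometry (TTouch)
open Literature.MathematicalPhysics.QuantumFieldTheory.Balaban1983to89.B12TreeDecay (K₀)
open Literature.MathematicalPhysics.QuantumFieldTheory.Balaban1983to89.ExpMeanLog (deltaSU)
open T4ContinuumYM4Torus (ForSmallCouplings)
open Summit.QuantumFields.BalabanUV.T4Continuum.Spine
open Summit.QuantumFields.BalabanUV.T4Continuum.Spine.NE5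
open Summit.QuantumFields.BalabanUV.T4Continuum.B13Carriers (transportRaw)
open YMDAG.UVSplit
open YMDAG.N18.HLayer
open YMDAG.N18.W1Reading (s_N18_readingAdmPlaqSmall₁₂_of_envelope_bound238 admTransport_plaqSmall_sharp n18At_readingAdm_iff mem_image_ofBackgroundC_iff)
open Node00 (Stage12Params datumOfRecord₁₂ IsRecordOfRecord₁₂C IsDatumOfRecord₁₂C NE3Letters₁₁ NE2Objects₁₁ ne3ConstLayerOfRecord₁₁ MatA ιSU prependCoupling avOfRecord)
open Node00.Sect2 (domCount domSys CPair ofBackgroundC cubeDom)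
open Node00.W1 (ReadingData LevelPairing LetterInputs ClusterTower pairOfRecord functionalC termC box AdmBg)
open Summit.QuantumFields.YangMills.BalabanUVNodes.N16Regime (InEndRegime)
open Summit.QuantumFields.YangMills.BalabanUVNodes.N16LeafSlot (LeafSlot)

variable {N : ℕ} [NeZero N] (cr : SpineReading₁₂ N)
  (S : (F : T4Family) → (θ : Stage12Params F N) → (k : ℕ) → ClusterTower (F.P k) (MatA N) θ.τ9.M)
  (a : (F : T4Family) → Stage12Params F N → ℕ → ℝ)
  (ha : ∀ (F : T4Family) (θ : Stage12Params F N) (k : ℕ), 0 < a F θ (k + 1))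
  (hstep : ∀ (F : T4Family) (θ : Stage12Params F N) (k : ℕ),
    ((F.P (k + 1)).L : ℝ) ^ 2 * a F θ (k + 1) + 143 * (((((F.P (k + 1)).d + 4) * (F.P (k + 1)).L : ℕ) : ℝ) ^ 2 / 4 * a F θ (k + 1)) ^ 2 ≤ a F θ k)
  (hguard : ∀ (F : T4Family) (θ : Stage12Params F N) (k : ℕ),
    ((((F.P (k + 1)).d + 4) * (F.P (k + 1)).L : ℕ) : ℝ) ^ 2 / 4 * a F θ (k + 1) ≤ deltaSU (Fin N) / 2)
  (gauge : (F : T4Family) → (θ : Stage12Params F N) → (k : ℕ) → GaugeField (F.P k) 0 (Node00.SU N) → GaugeField (F.P k) 0 (Node00.SU N) → ℝ)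
  (hg : ∀ (F : T4Family) (θ : Stage12Params F N) (k : ℕ) (U U' : GaugeField (F.P k) 0 (Node00.SU N)), 0 ≤ gauge F θ k U U')
  (li : (F : T4Family) → Stage12Params F N → LetterInputs) (ℓ₃ : T4Family → NE3Letters₁₁)
  (ne2 : (F : T4Family) → Stage12Params F N → (ℕ → ℝ) → List (ULoop F) → ℕ → NE2Objects₁₁)
  (ne1 : (F : T4Family) → Stage12Params F N → (ℕ → ℝ) → List (ULoop F) → NE1pCarriers)

/-! ## §1 The canonical home at the ε-small fields -/

section Canonical

open Classical in
/-- **N27 = B5 AT THE STAGE-12 RECORD FROM THE SLOTS AT THE CANONICAL HOME OF THE ADMISSIBLE READING ON THE PLAQUETTE-SMALL TABLES WITH THE TRANSPORT OF RECORD —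
N17 ∕ N22 ELIMINATED, N18 FROM THE END's DATA AT THE ε-SMALL FIELDS, NO TRANSPORT CLAUSE** (XXXI `spine_rec12C_at_readingAdm₁₂` at `(sp, T₀, hT) :=` (plaquette-small tables
of `a`, transport of record, `admTransport_plaqSmall_sharp a ha hstep hguard`)).  Rate side: NE1′ ∕ NE2 at `h.params` (displayed); NE3 as `InEndRegime ∧ LeafSlot` once per family;
N18 ⟸ dag-n18-d m13 §6 `s_N18_readingAdmPlaqSmall₁₂_of_envelope_bound238` — at every admissible tuple with provisos and run length `k`: THE END's data over the carriers of the
ADMISSIBLE plaquette-small pairing (step models with the NODE-A majorant as hypothesis, L01–L03, L07–L09*, numerals, L10, sharp clause) and `AnalyticH` ∕ `Bound238` of the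
towers `S F θ k ∕ (k+1)` at every step ON THE PLAQUETTE-SMALL TABLES of the two tori, letters dominating — VERBATIM (no embedding ∕ pairing ∕ restriction ∕ transport clause);
N22 ⟸ N18 by dag-n22-e 8a `s_N22_readingOfRecord₁₂_ofRecordAdm_of_s_N18_analytic` with the analytic letter (A) asked for every gauge field `U` of the `k`-th torus with
`PlaqSmall (a F θ k) U` (closed form), (J), eleven numerals; (D4) displayed on the admissible bundles; spine side as XXVII.  Side conditions on the thresholds: `ha`, `hstep`
([B7] (51)), `hguard`. [bookkeeping] -/
theorem spine_rec12C_at_epsSmallFields₁₂_of_envelope_bound238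
    (h14 : ∀ (F : T4Family) (D : Datum F N) (h : IsDatumOfRecord₁₂C F N D) (g₀ : ℕ → ℝ) (os : List (ULoop F)), N14At (ne1 F h.params g₀ os))
    (h15 : ∀ (F : T4Family) (D : Datum F N) (h : IsDatumOfRecord₁₂C F N D) (g₀ : ℕ → ℝ) (os : List (ULoop F)) (k : ℕ),
      N15At (ne2OfRecord₁₁ (ne2 F h.params g₀ os k)))
    (h16 : ∀ (F : T4Family), (∃ D : Datum F N, IsDatumOfRecord₁₂C F N D) →
      InEndRegime (ne3OfRecord₁₁ F (ne3ConstLayerOfRecord₁₁ F N (ℓ₃ F))) ∧ LeafSlot (ne3OfRecord₁₁ F (ne3ConstLayerOfRecord₁₁ F N (ℓ₃ F))))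
    -- N18 ⟸ THE END's data and the towers' H-layer data ON THE PLAQUETTE-SMALL TABLES (dag-n18-d module 13 §6, verbatim)
    (h18 : ∀ (F : T4Family) (θ : Stage12Params F N), θ.Provisos₁₂ F N → θ.Admissible F N → ∀ k : ℕ,
      ∃ (Op : Type) (_ : NormedAddCommGroup Op) (_ : NormedSpace ℂ Op) (Hist : Type) (_ : NormedAddCommGroup Hist) (_ : NormedSpace ℂ Hist)
        (Mb : ℝ → StepModel (LevelPairing.ofRecordAdm F θ.τ9.M N k (fun (k j : ℕ) (_ : (domSys (F.P k) θ.τ9.M j).Dom) =>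
            ofBackgroundC (ιSU N) '' {V : GaugeField (F.P k) 0 (Node00.SU N) | PlaqSmall (a F θ k) V})
          (gauge F θ k) (hg F θ k) (transportRaw F k (avOfRecord F N (k + 1) 0)) (admTransport_plaqSmall_sharp a ha hstep hguard F θ k)).carriers Op Hist)
        (act : ℝ → (j : ℕ) → Op × Hist → TDom 4 (domCount (F.P k) θ.τ9.M j) → ℂ) (γ' C3 ε₁ Rd κ A_A A_B E₁ δ δ' θr θ' cH ω ρ₀ B : ℝ) (k₀ : ℕ),
        (∀ b : ℝ, 0 < b → b ≤ γ' → ∀ (X : Node00.W1.Dom (F.P k) θ.τ9.M) (z : Op × Hist),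
          (Mb b).Out X.1 z.1 z.2 X =
            locE (TTouch (d := 4) (N := domCount (F.P k) θ.τ9.M X.1)) (fun Z : (tsys 4 (domCount (F.P k) θ.τ9.M X.1)).Dom => Z.1)
              (act b X.1 z) X.2.1) ∧
        0 ≤ C3 ∧ 0 ≤ ε₁ ∧ 0 ≤ κ ∧ κ + 2 * (64 * Real.log 162) + 2 ≤ Rd ∧
        C3 * ε₁ * Real.exp (5 * κ + 1) * K₀ 64 8 * 9 * 64 ≤ 1 ∧
        (∀ b : ℝ, 0 < b → b ≤ γ' → ∀ j, ∀ g ∈ Window γ',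
          ∀ (U : (LevelPairing.ofRecordAdm F θ.τ9.M N k (fun (k j : ℕ) (_ : (domSys (F.P k) θ.τ9.M j).Dom) =>
            ofBackgroundC (ιSU N) '' {V : GaugeField (F.P k) 0 (Node00.SU N) | PlaqSmall (a F θ k) V})
          (gauge F θ k) (hg F θ k) (transportRaw F k (avOfRecord F N (k + 1) 0)) (admTransport_plaqSmall_sharp a ha hstep hguard F θ k)).BgB) (q : Op × Hist),
          q ∈ (Mb b).Base j g U →
          ∃ V : Set (Op × Hist), IsOpen V ∧ (Mb b).box j q ⊆ V ∧
            (∀ Z : TDom 4 (domCount (F.P k) θ.τ9.M j), DifferentiableOn ℂ (fun z : Op × Hist => act b j z Z) V) ∧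
            (∀ z ∈ V, ∀ Z : TDom 4 (domCount (F.P k) θ.τ9.M j), ‖act b j z Z‖ ≤ C3 * ε₁ * Real.exp (-(Rd * torusTreeLen Z.1)))) ∧
        (∀ b : ℝ, 0 < b → b ≤ γ' → L01 (Mb b)
          ((LevelPairing.ofRecordAdm F θ.τ9.M N k (fun (k j : ℕ) (_ : (domSys (F.P k) θ.τ9.M j).Dom) =>
            ofBackgroundC (ιSU N) '' {V : GaugeField (F.P k) 0 (Node00.SU N) | PlaqSmall (a F θ k) V})
          (gauge F θ k) (hg F θ k) (transportRaw F k (avOfRecord F N (k + 1) 0)) (admTransport_plaqSmall_sharp a ha hstep hguard F θ k)).EA (S F θ k))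
          (Window γ')) ∧
        (∀ b : ℝ, 0 < b → b ≤ γ' → L02 (Mb b)
          ((LevelPairing.ofRecordAdm F θ.τ9.M N k (fun (k j : ℕ) (_ : (domSys (F.P k) θ.τ9.M j).Dom) =>
            ofBackgroundC (ιSU N) '' {V : GaugeField (F.P k) 0 (Node00.SU N) | PlaqSmall (a F θ k) V})
          (gauge F θ k) (hg F θ k) (transportRaw F k (avOfRecord F N (k + 1) 0)) (admTransport_plaqSmall_sharp a ha hstep hguard F θ k)).EB (S F θ (k + 1)) b)
          (Window γ')) ∧
        (∀ b : ℝ, 0 < b → b ≤ γ' → L03 (Mb b)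
          ((LevelPairing.ofRecordAdm F θ.τ9.M N k (fun (k j : ℕ) (_ : (domSys (F.P k) θ.τ9.M j).Dom) =>
            ofBackgroundC (ιSU N) '' {V : GaugeField (F.P k) 0 (Node00.SU N) | PlaqSmall (a F θ k) V})
          (gauge F θ k) (hg F θ k) (transportRaw F k (avOfRecord F N (k + 1) 0)) (admTransport_plaqSmall_sharp a ha hstep hguard F θ k)).EB (S F θ (k + 1)) b)
          (Window γ')) ∧
        (∀ b : ℝ, 0 < b → b ≤ γ' → L07 (Mb b) (Window γ') δ θr) ∧
        (∀ b : ℝ, 0 < b → b ≤ γ' → L08 (Mb b) (Window γ') κ (Real.exp 1 * 9 * 64 * K₀ 64 8 ^ 2 * A_B) δ' θr) ∧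
        (∀ b : ℝ, 0 < b → b ≤ γ' → L09aff (Mb b) (Window γ')) ∧ (∀ b : ℝ, 0 < b → b ≤ γ' → L09blind (Mb b) (Window γ')) ∧
        (∀ b : ℝ, 0 < b → b ≤ γ' → L09hom (Mb b) (Window γ')) ∧ (∀ b : ℝ, 0 < b → b ≤ γ' → L09unit (Mb b) (Window γ') κ E₁ cH ω) ∧
        0 < E₁ ∧ 0 ≤ δ + δ' ∧ 0 ≤ θr ∧ θr ≤ θ' ∧ θ' ≤ 1 ∧ 0 ≤ cH ∧ 0 < ω ∧ ρ₀ < 1 ∧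
        (δ + δ') * θr ^ k₀ +
            cH * (Real.exp 1 * 9 * 64 * K₀ 64 8 ^ 2 * A_A + Real.exp 1 * 9 * 64 * K₀ 64 8 ^ 2 * A_B) / (1 - ω) ≤ ρ₀ ∧
        0 ≤ B ∧ (∀ k < k₀, Real.exp 1 * 9 * 64 * K₀ 64 8 ^ 2 * A_A + Real.exp 1 * 9 * 64 * K₀ 64 8 ^ 2 * A_B ≤ B * θr ^ k) ∧
        Real.exp 1 * 9 * 64 * K₀ 64 8 ^ 2 * C3 * cH * ε₁ < (θ' - ω) * (1 - ρ₀) ∧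
        (∀ m, (S F θ k m).AnalyticH (box γ' m)
          (fun _ : (domSys (F.P k) θ.τ9.M (m + 1)).Dom => ofBackgroundC (ιSU N) '' {V : GaugeField (F.P k) 0 (Node00.SU N) | PlaqSmall (a F θ k) V})) ∧
        (∀ m, (S F θ k m).Bound238 (box γ' m)
          (fun _ : (domSys (F.P k) θ.τ9.M (m + 1)).Dom => ofBackgroundC (ιSU N) '' {V : GaugeField (F.P k) 0 (Node00.SU N) | PlaqSmall (a F θ k) V}) A_A Rd) ∧
        0 ≤ A_A ∧
        A_A * Real.exp (5 * κ + 1) * K₀ 64 8 * 9 * 64 < 1 ∧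
        (∀ m, (S F θ (k + 1) m).AnalyticH (box γ' m)
          (fun _ : (domSys (F.P (k + 1)) θ.τ9.M (m + 1)).Dom =>
            ofBackgroundC (ιSU N) '' {V : GaugeField (F.P (k + 1)) 0 (Node00.SU N) | PlaqSmall (a F θ (k + 1)) V})) ∧
        (∀ m, (S F θ (k + 1) m).Bound238 (box γ' m)
          (fun _ : (domSys (F.P (k + 1)) θ.τ9.M (m + 1)).Dom =>
            ofBackgroundC (ιSU N) '' {V : GaugeField (F.P (k + 1)) 0 (Node00.SU N) | PlaqSmall (a F θ (k + 1)) V}) A_B Rd) ∧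
        0 ≤ A_B ∧ A_B * Real.exp (5 * κ + 1) * K₀ 64 8 * 9 * 64 < 1 ∧
        θ.γ ≤ γ' ∧ (li F θ).κ ≤ κ ∧ θ' ≤ (li F θ).θ₅ ∧
        (Real.exp 1 * 9 * 64 * K₀ 64 8 ^ 2 * (C3 * ε₁) / (1 - ρ₀) * (δ + δ') + B) * (θ' - ω) /
            (θ' - (ω + Real.exp 1 * 9 * 64 * K₀ 64 8 ^ 2 * (C3 * ε₁) / (1 - ρ₀) * cH)) ≤ (li F θ).C₅)
    -- N22 ⟸ N18 (dag-n22-e module 8a, analytic sup-letter currency), the letter (A) asked AT THE ε-SMALL FIELDS `PlaqSmall (a F θ k) U`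
    (hjunk : ∀ (F : T4Family) (θ : Stage12Params F N), θ.Provisos₁₂ F N → θ.Admissible F N →
      ∀ (k : ℕ) (X : Node00.W1.Dom (F.P k) θ.τ9.M), k < X.1 → ∀ (g : ℕ → ℝ) (φ : CPair (F.P k) (MatA N)), functionalC (S F θ k) g φ X = 0)
    (hA : ∀ (F : T4Family) (θ : Stage12Params F N), θ.Provisos₁₂ F N → θ.Admissible F N → ∀ (k : ℕ),
      ∀ g ∈ Window θ.γ, ∀ (U : GaugeField (F.P k) 0 (Node00.SU N)), PlaqSmall (a F θ k) U → ∀ (X : Node00.W1.Dom (F.P k) θ.τ9.M) (i : ℕ), i < X.1 →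
        ∃ (Fz : ℂ → ℂ) (Dset : Set ℂ), DifferentiableOn ℂ Fz Dset ∧
          (∀ z ∈ Dset, ‖Fz z‖ ≤ (li F θ).A * (li F θ).μ ^ (X.1 - 1 - i) * Real.exp (-((li F θ).κ * (domSys (F.P k) θ.τ9.M X.1).dj X.2))) ∧
          (∀ t ∈ Ioc (0 : ℝ) θ.γ, closedBall (t : ℂ) (li F θ).r ⊆ Dset) ∧
          (∀ t ∈ Ioc (0 : ℝ) θ.γ, Fz t = ((functionalC (S F θ k) (Function.update g i t) (ofBackgroundC (ιSU N) U) X).re : ℂ)))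
    (hnum : ∀ (F : T4Family) (θ : Stage12Params F N), θ.Provisos₁₂ F N → θ.Admissible F N →
      0 < (li F θ).C₀ ∧ 0 < (li F θ).θ₅ ∧ (li F θ).θ₅ < 1 ∧ 0 ≤ (li F θ).C₅ ∧ 2 * (li F θ).C₅ / (1 - (li F θ).θ₅) ≤ (li F θ).C₀ ∧ 0 < (li F θ).A ∧
        (li F θ).θ₅ ≤ (li F θ).μ ∧ (li F θ).C₀ ≤ 2 * (li F θ).A ∧ 0 < (li F θ).r ∧ 0 < (li F θ).s ∧ (li F θ).s < 1)
    (hD4 : ∀ (F : T4Family) (D : Datum F N) (h : IsDatumOfRecord₁₂C F N D) (k : ℕ), ReadOutAt D (u3OfRecord₁₂ h.params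
      ((ReadingData.ofRecordAdm F h.params.τ9.M N (S F h.params)
        (fun (k j : ℕ) (_ : (domSys (F.P k) h.params.τ9.M j).Dom) => ofBackgroundC (ιSU N) '' {V : GaugeField (F.P k) 0 (Node00.SU N) | PlaqSmall (a F h.params k) V})
        (gauge F h.params) (hg F h.params) (fun k => transportRaw F k (avOfRecord F N (k + 1) 0)) (admTransport_plaqSmall_sharp a ha hstep hguard F h.params)
        (li F h.params)).u3Objects h.params.γ) k))
    (hx' : S_N27x (fun F D w => IsRecordOfRecord₁₂C F N D w) (SRec₁₂ cr)) (h20 : S_N20 (SRec₁₂ cr)) (h21 : S_N21 (SRec₁₂ cr))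
    (h19 : ∀ (F : T4Family) (θ : Stage12Params F N) (hP : θ.Provisos₁₂ F N), θ.Admissible F N → ∀ (g₀ : ℕ → ℝ) (os : List (ULoop F))
      (h : IsDatumOfRecord₁₂C F N (datumOfRecord₁₂ F N θ hP)) (k : ℕ),
      RatesAt (datumOfRecord₁₂ F N θ hP) (rateCarriersOfRecord₁₂ (readingOfRecord₁₂
        (fun F θ => ReadingData.ofRecordAdm F θ.τ9.M N (S F θ)
          (fun (k j : ℕ) (_ : (domSys (F.P k) θ.τ9.M j).Dom) => ofBackgroundC (ιSU N) '' {V : GaugeField (F.P k) 0 (Node00.SU N) | PlaqSmall (a F θ k) V})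
          (gauge F θ) (hg F θ) (fun k => transportRaw F k (avOfRecord F N (k + 1) 0)) (admTransport_plaqSmall_sharp a ha hstep hguard F θ) (li F θ)) ℓ₃ ne2 ne1)
          F h.params h.provisos g₀ os k) → letI := (cr F θ hP g₀ os).dec
        ∃ δ : ℕ → ℝ, NE7.Core (cr F θ hP g₀ os).l₀ (cr F θ hP g₀ os).vol (cr F θ hP g₀ os).T (cr F θ hP g₀ os).Bad
          (fun K t τ => (cr F θ hP g₀ os).A K t τ - (cr F θ hP g₀ os).shA K t τ) (fun K t τ => (cr F θ hP g₀ os).B K t τ - (cr F θ hP g₀ os).shB K t τ) δ ∧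
          Summable δ) :
    Spine (N := N) fun F D w => IsRecordOfRecord₁₂C F N D w :=
  spine_rec12C_at_readingAdm₁₂ cr S
    (fun F θ (k j : ℕ) (_ : (domSys (F.P k) θ.τ9.M j).Dom) => ofBackgroundC (ιSU N) '' {V : GaugeField (F.P k) 0 (Node00.SU N) | PlaqSmall (a F θ k) V})
    gauge hg (fun F _ k => transportRaw F k (avOfRecord F N (k + 1) 0)) (admTransport_plaqSmall_sharp a ha hstep hguard) li ℓ₃ ne2 ne1 h14 h15 h16
    (s_N18_readingAdmPlaqSmall₁₂_of_envelope_bound238 S a (admTransport_plaqSmall_sharp a ha hstep hguard) gauge hg li ℓ₃ ne2 ne1 h18) hjunk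
    (fun F θ hP hθ k g hgW U X i hi =>
      hA F θ hP hθ k g hgW U.1 ((mem_image_ofBackgroundC_iff _ U.1).1 (U.2 0 (cubeDom (F.P k) θ.τ9.M 0 fun _ => 0))) X i hi)
    hnum hD4 hx' h20 h21 h19

end Canonical

/-! ## §2 The regime-restricted home at the ε-small fields, any regime `Rg` -/

section Regime

variable (Rg : (F : T4Family) → Stage12Params F N → Prop)

/-- **N27 = B5 AT THE REGIME RECORD CLASS `IsRecordOfRecord₁₂COn F N Rg` FROM THE SLOTS AT THE REGIME HOME OF THE ADMISSIBLE READING ON THE PLAQUETTE-SMALL TABLES WITH THE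
TRANSPORT OF RECORD, ANY `Rg` — N17 ∕ N22 ELIMINATED, N18 IN CLOSED FORM AT THE ε-SMALL FIELDS** (XXXI `spine_rec12COn_at_readingAdm₁₂` at the same `(sp, T₀, hT)`).  For every
family and every Stage-12 tuple `θ` with provisos IN THE REGIME, admissible: NE1′ ∕ NE2 at θ (displayed); NE3 once per guarded family; N18 DISPLAYED IN CLOSED FORM: for every run
length `k`, member `b ∈ ]0, θ.γ]`, history `g ∈ ]0, θ.γ]^ℕ`, every gauge field `U` of the `(k+1)`-th torus with `PlaqSmall (a F θ (k+1)) U` («|∂U − 1| < a_{k+1}», [I] (0.18)) and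
run-A domain `(j, X)`: `|Re E^{(j)}_{S F θ k}(X; g; (ι(transportRaw F k (avOfRecord F N (k+1) 0) U), 0)) − Re E^{(j+1)}_{S F θ (k+1)}(pairOfRecord (j, X); b∷g; (ιU, 0))| ≤
C₅·θ₅^j·e^{−κ d_j(X)}` with the letters `li F θ`; N22 ⟸ N18 by dag-n22-e 8a `…On_ofRecordAdm_of_s_N18_stripBound` with STRIP-(1.18) asked for the terms `E^{(j)}_{S F θ k}(Y; g[i ↦ ·]; (ιV, 0))`
at every `V` with `PlaqSmall (a F θ k) V` (closed form), (J), twelve numerals; (D4) at θ displayed; spine side as XXVIII.  At `Rg := Node00.unityNondeg₁₂ N`, `N = 2` THE ITEM is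
XXVI §6 `spineGivenEndpointR12_of_spine_rec12COn` of this. [bookkeeping] -/
theorem spine_rec12COn_at_epsSmallFields₁₂
    (h14 : ∀ (F : T4Family) (θ : Stage12Params F N), θ.Provisos₁₂ F N → Rg F θ → θ.Admissible F N → ∀ (g₀ : ℕ → ℝ) (os : List (ULoop F)),
      N14At (ne1 F θ g₀ os))
    (h15 : ∀ (F : T4Family) (θ : Stage12Params F N), θ.Provisos₁₂ F N → Rg F θ → θ.Admissible F N → ∀ (g₀ : ℕ → ℝ) (os : List (ULoop F)) (k : ℕ),
      N15At (ne2OfRecord₁₁ (ne2 F θ g₀ os k)))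
    (h16 : ∀ (F : T4Family), (∃ θ : Stage12Params F N, θ.Provisos₁₂ F N ∧ Rg F θ ∧ θ.Admissible F N) →
      InEndRegime (ne3OfRecord₁₁ F (ne3ConstLayerOfRecord₁₁ F N (ℓ₃ F))) ∧ LeafSlot (ne3OfRecord₁₁ F (ne3ConstLayerOfRecord₁₁ F N (ℓ₃ F))))
    -- N18 in closed form AT THE ε-SMALL FIELDS with the transport of record
    (h18 : ∀ (F : T4Family) (θ : Stage12Params F N), θ.Provisos₁₂ F N → Rg F θ → θ.Admissible F N → ∀ (k : ℕ) (b : ℝ), 0 < b → b ≤ θ.γ →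
      ∀ g ∈ Window θ.γ, ∀ (U : GaugeField (F.P (k + 1)) 0 (Node00.SU N)), PlaqSmall (a F θ (k + 1)) U → ∀ (X : Node00.W1.Dom (F.P k) θ.τ9.M),
        |(functionalC (S F θ k) g (ofBackgroundC (ιSU N) (transportRaw F k (avOfRecord F N (k + 1) 0) U)) X).re -
            (functionalC (S F θ (k + 1)) (prependCoupling b g) (ofBackgroundC (ιSU N) U) (pairOfRecord F θ.τ9.M k X)).re| ≤
          (li F θ).C₅ * (li F θ).θ₅ ^ X.1 * Real.exp (-((li F θ).κ * (domSys (F.P k) θ.τ9.M X.1).dj X.2)))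
    -- N22 ⟸ N18 (dag-n22-e module 8a, STRIP currency), STRIP-(1.18) asked AT THE ε-SMALL FIELDS of the `k`-th torus
    (hjunk : ∀ (F : T4Family) (θ : Stage12Params F N), θ.Provisos₁₂ F N → Rg F θ → θ.Admissible F N →
      ∀ (k : ℕ) (X : Node00.W1.Dom (F.P k) θ.τ9.M), k < X.1 → ∀ (g : ℕ → ℝ) (φ : CPair (F.P k) (MatA N)), functionalC (S F θ k) g φ X = 0)
    (hnum : ∀ (F : T4Family) (θ : Stage12Params F N), θ.Provisos₁₂ F N → Rg F θ → θ.Admissible F N →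
      0 < (li F θ).C₀ ∧ 0 < (li F θ).θ₅ ∧ (li F θ).θ₅ < 1 ∧ 0 ≤ (li F θ).C₅ ∧ 2 * (li F θ).C₅ / (1 - (li F θ).θ₅) ≤ (li F θ).C₀ ∧ 0 < (li F θ).A ∧
        (li F θ).θ₅ ≤ (li F θ).μ ∧ (li F θ).C₀ ≤ 2 * (li F θ).A ∧ 0 < (li F θ).r ∧ 0 < (li F θ).s ∧ (li F θ).s < 1 ∧ 1 ≤ (li F θ).μ)
    (hstrip : ∀ (F : T4Family) (θ : Stage12Params F N), θ.Provisos₁₂ F N → Rg F θ → θ.Admissible F N → ∀ (k : ℕ),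
      ∀ (j : ℕ) (g : ℕ → ℝ), g ∈ Window θ.γ → ∀ (i : ℕ) (Y : (domSys (F.P k) θ.τ9.M j).Dom) (V : GaugeField (F.P k) 0 (Node00.SU N)), PlaqSmall (a F θ k) V →
        ∃ (Ec : ℂ → ℂ) (O : Set ℂ), IsOpen O ∧ (∀ t ∈ Ioc (0 : ℝ) θ.γ, closedBall (t : ℂ) (li F θ).r ⊆ O) ∧ DifferentiableOn ℂ Ec O ∧
          (∀ z ∈ O, ‖Ec z‖ ≤ (li F θ).A * Real.exp (-((li F θ).κ * torusTreeLen Y.1))) ∧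
          (∀ t ∈ Ioc (0 : ℝ) θ.γ, Ec t = termC (S F θ k) j Y (Function.update g i t) (ofBackgroundC (ιSU N) V)))
    (hD4 : ∀ (F : T4Family) (θ : Stage12Params F N) (hP : θ.Provisos₁₂ F N), Rg F θ → θ.Admissible F N → ∀ k : ℕ,
      ReadOutAt (datumOfRecord₁₂ F N θ hP) (u3OfRecord₁₂ θ
        ((ReadingData.ofRecordAdm F θ.τ9.M N (S F θ)
          (fun (k j : ℕ) (_ : (domSys (F.P k) θ.τ9.M j).Dom) => ofBackgroundC (ιSU N) '' {V : GaugeField (F.P k) 0 (Node00.SU N) | PlaqSmall (a F θ k) V})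
          (gauge F θ) (hg F θ) (fun k => transportRaw F k (avOfRecord F N (k + 1) 0)) (admTransport_plaqSmall_sharp a ha hstep hguard F θ) (li F θ)).u3Objects θ.γ) k))
    (h20 : S_N20 (SRec₁₂On cr Rg)) (h21 : S_N21 (SRec₁₂On cr Rg))
    (hx : ∀ (F : T4Family) (θ : Stage12Params F N) (hP : θ.Provisos₁₂ F N), Rg F θ → θ.Admissible F N →
      B16.EndStatementBPrinted (datumOfRecord₁₂ F N θ hP).C → DagBinding.EndpointExistence (datumOfRecord₁₂ F N θ hP).C.toB12 →
        ForSmallCouplings (datumOfRecord₁₂ F N θ hP) fun g₀ => ∀ os : List (ULoop F),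
          0 < (cr F θ hP g₀ os).l₀ ∧ 0 < (cr F θ hP g₀ os).vol ∧
          (∀ (K : ℕ) (t : ℝ), |t| ≤ (cr F θ hP g₀ os).l₀ →
            T4GenFunBounds.schemeZ ((datumOfRecord₁₂ F N θ hP).scheme g₀) os ((cr F θ hP g₀ os).K₀ + K) t =
              ∑ τ ∈ (cr F θ hP g₀ os).T K, (cr F θ hP g₀ os).A K t τ) ∧
          (∀ (K : ℕ) (t : ℝ), |t| ≤ (cr F θ hP g₀ os).l₀ →
            T4GenFunBounds.schemeZ ((datumOfRecord₁₂ F N θ hP).scheme g₀) os ((cr F θ hP g₀ os).K₀ + K + 1) t =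
              ∑ τ ∈ (cr F θ hP g₀ os).T K, (cr F θ hP g₀ os).B K t τ))
    (h19 : ∀ (F : T4Family) (θ : Stage12Params F N) (hP : θ.Provisos₁₂ F N), Rg F θ → θ.Admissible F N → ∀ (g₀ : ℕ → ℝ) (os : List (ULoop F)),
      (∀ k : ℕ, RatesAt (datumOfRecord₁₂ F N θ hP) (rateCarriersOfRecord₁₂ (readingOfRecord₁₂
        (fun F θ => ReadingData.ofRecordAdm F θ.τ9.M N (S F θ)
          (fun (k j : ℕ) (_ : (domSys (F.P k) θ.τ9.M j).Dom) => ofBackgroundC (ιSU N) '' {V : GaugeField (F.P k) 0 (Node00.SU N) | PlaqSmall (a F θ k) V})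
          (gauge F θ) (hg F θ) (fun k => transportRaw F k (avOfRecord F N (k + 1) 0)) (admTransport_plaqSmall_sharp a ha hstep hguard F θ) (li F θ)) ℓ₃ ne2 ne1)
          F θ hP g₀ os k)) →
        letI := (cr F θ hP g₀ os).dec
        ∃ δ : ℕ → ℝ, NE7.Core (cr F θ hP g₀ os).l₀ (cr F θ hP g₀ os).vol (cr F θ hP g₀ os).T (cr F θ hP g₀ os).Bad
          (fun K t τ => (cr F θ hP g₀ os).A K t τ - (cr F θ hP g₀ os).shA K t τ) (fun K t τ => (cr F θ hP g₀ os).B K t τ - (cr F θ hP g₀ os).shB K t τ) δ ∧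
          Summable δ) :
    Spine (N := N) fun F D w => Node00.IsRecordOfRecord₁₂COn F N Rg D w :=
  spine_rec12COn_at_readingAdm₁₂ cr S
    (fun F θ (k j : ℕ) (_ : (domSys (F.P k) θ.τ9.M j).Dom) => ofBackgroundC (ιSU N) '' {V : GaugeField (F.P k) 0 (Node00.SU N) | PlaqSmall (a F θ k) V})
    gauge hg (fun F _ k => transportRaw F k (avOfRecord F N (k + 1) 0)) (admTransport_plaqSmall_sharp a ha hstep hguard) li ℓ₃ ne2 ne1 Rg h14 h15 h16
    (fun F θ hP hRg hθ k b hb hbγ g hgW U X =>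
      h18 F θ hP hRg hθ k b hb hbγ g hgW U.1 ((mem_image_ofBackgroundC_iff _ U.1).1 (U.2 0 (cubeDom (F.P (k + 1)) θ.τ9.M 0 fun _ => 0))) X)
    hjunk hnum
    (fun F θ hP hRg hθ k j g hgW i Y ψ hψ => by
      obtain ⟨V, hV, rfl⟩ := hψ
      exact hstrip F θ hP hRg hθ k j g hgW i Y V hV)
    hD4 h20 h21 hx h19

end Regime

end Summit.QuantumFields.YangMills.Theorems.BalabanUVNodesN27SpineRecord

end
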